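import Mathlib.Analysis.Complex.LocallyUniformLimit
import Mathlib.Analysis.Complex.RemovableSingularity
import Mathlib.MeasureTheory.Integral.IntervalIntegral.FundThmCalculus
import Literature.Analysis.Complex.RiemannMapping
import Literature.Analysis.Complex.InjectiveHolomorphic
import Literature.Analysis.Complex.KoebeQuarterProofs
import Literature.Probability.RandomPlanarGeometry.WholePlaneLoewnerBackwardFlow
import HarnessLib

/-!
# The whole-plane Loewner equation: the inverse Loewner map `F_t = invMap lam t` of the backward flow

Topic `Probability/RandomPlanarGeometry`. Second of the three `…Backward…` files proving the
existence half of `WholePlaneLoewnerChain.exists_unique` (Lawler (2005), Prop. 4.21). Along the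
orbit `u_s = orbit lam t w s` (`|w| > 1`, `s ≤ t`; `WholePlaneLoewnerBackwardFlow`) the conjugated
point `v_s = e^s u_s` converges as `s → -∞`, and the limit `F_t(w) = invMap lam t w` is Lawler's
inverse whole-plane Loewner map `F_t : ℂ ∖ 𝔻̄ → D_t` (Prop. 4.21: `F_t = lim_{s → -∞} F_t^{(s)}`,
here pointwise along the orbit with explicit exponential rates in place of Lemma 4.20). We prove
that `F_t` is univalent with `F_t(w) ∼ e^t w` at `∞` and control its image near `∞` by Koebe's
one-quarter theorem.

* The limit. `ζ_s = χ_s + s = log v_s` has derivative `logField + 1 = 2p/(p - 1)` of norm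
  `≤ (2/(|w| - 1)) e^{-c_w (t - s)}`, so `ζ_s` is Cauchy at `-∞` (`dist_zeta_le`,
  `exists_tendsto_atBot_of_dist_le`): `logLim lam t w = lim ζ_s`,
  `|logLim - (log w + t)| ≤ M_w := 2(|w| + 1)/(|w| - 1)²` (`norm_logLim_sub_le`);
  `invMap lam t w = exp (logLim lam t w) = lim e^s u_s(w)` (`tendsto_exp_mul_orbit`), non-zero,
  `e^{t - M_w}|w| ≤ |F_t(w)| ≤ e^{t + M_w}|w|`, `|F_t(w)/(e^t w) - 1| ≤ 2 M_w` for `M_w ≤ 1`; flow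
  property `invMap t' (orbit t w t') = invMap t w` and its forward version; **`F_t` is injective
  on `{|w| > 1}`** (`injOn_invMap`, by `eqOn_of_tendsto_atBot`).
* Holomorphy (Lawler (2005), §4.1, proof of Thm. 4.6, eqs. (4.6)–(4.8), as in the tree's
  `LoewnerFlow`): differences of orbits solve a LINEAR equation,
  `u_s(w) - u_s(w₀) = (w - w₀) exp ∫ₜˢ a` (`sub_eq_mul_exp_integral`, coefficient `flowCoeff`),
  whence `w ↦ orbit lam t w s` is holomorphic (`hasDerivAt_orbit_initial`); `e^s u_s(·) → F_t`
  locally uniformly (`tendstoLocallyUniformlyOn_exp_mul_orbit`), so **`F_t` is holomorphic**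
  (`differentiableOn_invMap`), `F_t' ≠ 0`, and `D_t = F_t({|w| > 1})` is open
  (`isOpen_image_invMap`).
* Koebe at infinity. `koebeAtInfty lam t ζ = 1/F_t(1/ζ)`, `= 0` at `0`, is univalent on the unit
  disc with derivative `e^{-t}` at `0` (removable singularity; Lawler (2005), §3.2,
  `F_K = 1/f_K(1/·)`, `cap K = -log f_K'(0)`); Koebe's one-quarter theorem
  (`Literature.Analysis.Complex.koebeQuarter_holds`, Lawler Thm. 3.17) gives
  **`{|z| > 4e^t} ⊆ D_t`** (`mem_image_invMap_of_lt`), **`|F_t(w)| ≤ 4Re^t` for `|w| ≤ R`**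
  (`norm_invMap_le_of_norm_le`), and the **capacity normalisation `z/g_t(z) → e^t`** as `z → ∞` in
  `D_t`, `g_t = F_t⁻¹` (`tendsto_div_invFunOn_invMap`).

Everything is proved; no named fact is introduced (D-0026).

## References

* G. F. Lawler, *Conformally Invariant Processes in the Plane*, AMS (2005), §4.3, Lemma 4.20 and
  Prop. 4.21; §4.1 (proof of Thm. 4.6); §3.2 and Thm. 3.17 (compact hulls, Koebe) [Lawler2005].

## Mathlib / tree

Mathlib: `Metric.cauchy_iff`, `CompleteSpace.complete`, `Complex.norm_exp_sub_one_le`,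
`constant_of_has_deriv_right_zero`, `Continuous.integral_hasStrictDerivAt`,
`hasDerivAt_iff_tendsto_slope`, `TendstoLocallyUniformlyOn.differentiableOn`,
`Complex.analyticAt_of_differentiable_on_punctured_nhds_of_continuousAt`. Tree:
`Complex.isOpen_image_of_deriv_ne_zero` (`RiemannMapping`), `SCV.deriv_ne_zero_of_injOn`
(`InjectiveHolomorphic`), `koebeQuarter_holds` (`KoebeQuarterProofs`).
-/

noncomputable section

open Set Filter Metric Complex
open scoped Topology NNReal

namespace Literature.Probability.RandomPlanarGeometry

namespace WholePlaneLoewner.BackwardFlow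

/-- The exterior of the closed unit disc is open (a private copy of the sibling
`WholePlaneSLEProofs`'s `isOpen_exteriorDisc`, keeping this file independent of it). [folklore] -/
private theorem isOpen_exteriorDisc : IsOpen exteriorDisc :=
  isOpen_lt continuous_const continuous_norm

/-! ### A Cauchy criterion at `-∞` with exponential rate -/

/-- If `dist (f b) (f a) ≤ C e^{-c (t - b)}` for all `a ≤ b ≤ t` (`c > 0`), then `f` has a limit
`L` at `-∞` and `dist (f b) L ≤ C e^{-c (t - b)}` for `b ≤ t`. [folklore] -/
theorem exists_tendsto_atBot_of_dist_le {f : ℝ → ℂ} {t C c : ℝ} (hc : 0 < c)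
    (h : ∀ a b, a ≤ b → b ≤ t → dist (f b) (f a) ≤ C * Real.exp (-(c * (t - b)))) :
    ∃ L, Tendsto f atBot (𝓝 L) ∧ ∀ b ≤ t, dist (f b) L ≤ C * Real.exp (-(c * (t - b))) := by
  -- the bound tends to `0` as `b → -∞`
  have hto : Tendsto (fun b ↦ C * Real.exp (-(c * (t - b)))) atBot (𝓝 0) := by
    have h1 : Tendsto (fun b : ℝ ↦ -(c * (t - b))) atBot atBot := by
      have : (fun b : ℝ ↦ -(c * (t - b))) = fun b ↦ c * b + -(c * t) := by ext b; ring
      rw [this]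
      exact tendsto_atBot_add_const_right _ _ (tendsto_id.const_mul_atBot hc)
    simpa using (Real.tendsto_exp_atBot.comp h1).const_mul C
  -- Cauchy
  have hcauchy : Cauchy (map f atBot) := by
    rw [Metric.cauchy_iff]
    refine ⟨map_neBot, fun ε hε ↦ ?_⟩
    obtain ⟨b, hb⟩ := eventually_atBot.1 ((hto.eventually (gt_mem_nhds (half_pos hε))).and
      (eventually_le_atBot t))
    have hbε : C * Real.exp (-(c * (t - b))) < ε / 2 := (hb b le_rfl).1
    have hbt : b ≤ t := (hb b le_rfl).2
    refine ⟨f '' Iic b, image_mem_map (Iic_mem_atBot b), ?_⟩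
    rintro _ ⟨a₁, ha₁, rfl⟩ _ ⟨a₂, ha₂, rfl⟩
    calc dist (f a₁) (f a₂) ≤ dist (f b) (f a₁) + dist (f b) (f a₂) := dist_triangle_left _ _ _
      _ ≤ C * Real.exp (-(c * (t - b))) + C * Real.exp (-(c * (t - b))) :=
          add_le_add (h a₁ b ha₁ hbt) (h a₂ b ha₂ hbt)
      _ < ε := by linarith
  obtain ⟨L, hL⟩ := CompleteSpace.complete hcauchy
  have hlim : Tendsto f atBot (𝓝 L) := hL
  refine ⟨L, hlim, fun b hb ↦ ?_⟩
  have h1 : Tendsto (fun a ↦ dist (f b) (f a)) atBot (𝓝 (dist (f b) L)) :=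
    tendsto_const_nhds.dist hlim
  exact le_of_tendsto h1 (eventually_atBot.2 ⟨b, fun a ha ↦ h a b ha hb⟩)

/-! ### The conjugated logarithmic trajectory `ζ_s = χ_s + s` converges at `-∞` -/

variable {lam : ℝ → ℝ}

/-- The **error constant** `M_w = 2(|w| + 1)/(|w| - 1)²`, bounding `|log f_t(w) - log (e^t w)|`.
[folklore] -/
def errConst (w : ℂ) : ℝ := 2 * (‖w‖ + 1) / (‖w‖ - 1) ^ 2

/-- The **growth constant** `c_w = (|w| - 1)/(|w| + 1)` of the backward flow. [folklore] -/
def growthConst (w : ℂ) : ℝ := (‖w‖ - 1) / (‖w‖ + 1)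

/-- Unfolding lemma. [folklore] -/
theorem errConst_apply (w : ℂ) : errConst w = 2 * (‖w‖ + 1) / (‖w‖ - 1) ^ 2 := rfl

/-- Unfolding lemma. [folklore] -/
theorem growthConst_apply (w : ℂ) : growthConst w = (‖w‖ - 1) / (‖w‖ + 1) := rfl

/-- `c_w > 0` for `|w| > 1`. [folklore] -/
theorem growthConst_pos' {w : ℂ} (hw : 1 < ‖w‖) : 0 < growthConst w :=
  div_pos (by linarith) (by linarith)

/-- `M_w > 0` for `|w| > 1`. [folklore] -/
theorem errConst_pos {w : ℂ} (hw : 1 < ‖w‖) : 0 < errConst w := by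
  unfold errConst; exact div_pos (by linarith) (by nlinarith)

/-- `M_w = 2/((|w| - 1) c_w)`. [folklore] -/
theorem errConst_eq {w : ℂ} (hw : 1 < ‖w‖) : errConst w = 2 / ((‖w‖ - 1) * growthConst w) := by
  rw [errConst_apply, growthConst_apply]
  have h1 : ‖w‖ - 1 ≠ 0 := by linarith
  have h2 : ‖w‖ + 1 ≠ 0 := by linarith
  field_simp

/-- `c_w` is increasing in `|w|`. [folklore] -/
theorem growthConst_mono {w w' : ℂ} (hw : 1 < ‖w‖) (h : ‖w‖ ≤ ‖w'‖) :
    growthConst w ≤ growthConst w' := by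
  rw [growthConst_apply, growthConst_apply, div_le_div_iff₀ (by linarith) (by linarith)]
  nlinarith

/-- `M_w` is decreasing in `|w|`. [folklore] -/
theorem errConst_anti {w w' : ℂ} (hw : 1 < ‖w‖) (h : ‖w‖ ≤ ‖w'‖) : errConst w' ≤ errConst w := by
  rw [errConst_apply, errConst_apply, div_le_div_iff₀ (by nlinarith) (by nlinarith)]
  have h1 : 0 ≤ ‖w'‖ - ‖w‖ := by linarith
  nlinarith [mul_nonneg h1 (by nlinarith : (0 : ℝ) ≤ (‖w‖ - 1) * (‖w'‖ + ‖w‖ + 3 - 1)),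
    mul_nonneg h1 (by linarith : (0 : ℝ) ≤ ‖w'‖ - 1), mul_nonneg (mul_nonneg h1 h1) (by linarith :
    (0 : ℝ) ≤ ‖w‖ + 1)]

section Zeta

variable (hlam : Continuous lam) {t : ℝ} {w : ℂ} (hw : 1 < ‖w‖)
include hlam hw

/-- **The derivative of `ζ_s = χ_s + s` is exponentially small**:
`|logField (s, χ_s) + 1| ≤ (2/(|w| - 1)) e^{-c_w (t - s)}` for `s ≤ t`. [folklore] -/
theorem norm_logField_logOrbit_add_one_le {s : ℝ} (hs : s ≤ t) :
    ‖logField lam s (logOrbit lam t w s) + 1‖ ≤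
      2 / (‖w‖ - 1) * Real.exp (-(growthConst w * (t - s))) := by
  set p := pTerm lam s (logOrbit lam t w s) with hp
  have hw0 : (0 : ℝ) < ‖w‖ := by linarith
  have hple : ‖p‖ ≤ ‖w‖⁻¹ * Real.exp (-(growthConst w * (t - s))) :=
    norm_pTerm_logOrbit_le hlam hw hs
  have hexp1 : Real.exp (-(growthConst w * (t - s))) ≤ 1 := by
    rw [Real.exp_le_one_iff, neg_nonpos]
    exact mul_nonneg (growthConst_pos' hw).le (by linarith)
  have hpw : ‖p‖ ≤ ‖w‖⁻¹ := hple.trans (mul_le_of_le_one_right (inv_nonneg.2 hw0.le) hexp1)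
  have hwinv : ‖w‖⁻¹ < 1 := inv_lt_one_of_one_lt₀ hw
  have hp1 : ‖p‖ < 1 := hpw.trans_lt hwinv
  refine (norm_logField_add_one_le lam s hp1).trans ?_
  -- `2|p|/(1 - |p|) ≤ 2|p| |w|/(|w| - 1) ≤ (2/(|w| - 1)) e^{-c (t - s)}`
  have hden : (‖w‖ - 1) / ‖w‖ ≤ 1 - ‖p‖ := by
    rw [div_le_iff₀ hw0]
    have : ‖p‖ * ‖w‖ ≤ 1 := by
      calc ‖p‖ * ‖w‖ ≤ ‖w‖⁻¹ * ‖w‖ := mul_le_mul_of_nonneg_right hpw hw0.le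
        _ = 1 := inv_mul_cancel₀ hw0.ne'
    nlinarith
  have hdenpos : 0 < (‖w‖ - 1) / ‖w‖ := div_pos (by linarith) hw0
  calc 2 * ‖p‖ / (1 - ‖p‖) ≤ 2 * (‖w‖⁻¹ * Real.exp (-(growthConst w * (t - s)))) / ((‖w‖ - 1) / ‖w‖) :=
        div_le_div₀ (by positivity) (by linarith) hdenpos hden
    _ = 2 / (‖w‖ - 1) * Real.exp (-(growthConst w * (t - s))) := by
        field_simp

/-- `ζ_s = χ_s + s` has derivative `logField + 1` for `s ≤ t`. [folklore] -/
theorem hasDerivAt_zeta {s : ℝ} (hs : s ≤ t) :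
    HasDerivAt (fun r ↦ logOrbit lam t w r + r) (logField lam s (logOrbit lam t w s) + 1) s := by
  have h1 := hasDerivAt_logOrbit hlam hw hs
  have h2 : HasDerivAt (fun r : ℝ ↦ (r : ℂ)) 1 s := by simpa using (hasDerivAt_id s).ofReal_comp
  exact h1.add h2

/-- **Exponential Cauchy estimate for `ζ`**: for `a ≤ b ≤ t`,
`dist ζ_b ζ_a ≤ M_w (e^{-c_w (t - b)} - e^{-c_w (t - a)}) ≤ M_w e^{-c_w (t - b)}`. [folklore] -/
theorem dist_zeta_le {a b : ℝ} (hab : a ≤ b) (hbt : b ≤ t) :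
    dist (logOrbit lam t w b + b) (logOrbit lam t w a + a) ≤
      errConst w * Real.exp (-(growthConst w * (t - b))) := by
  set c := growthConst w with hc
  have hcpos : 0 < c := growthConst_pos' hw
  set ζ : ℝ → ℂ := fun r ↦ logOrbit lam t w r + r with hζ
  set B : ℝ → ℝ := fun x ↦ 2 / ((‖w‖ - 1) * c) * (Real.exp (-(c * (t - x))) - Real.exp (-(c * (t - a))))
    with hB
  have hcont : ContinuousOn (fun x ↦ ζ x - ζ a) (Icc a b) := fun x hx ↦
    ((hasDerivAt_zeta hlam hw (hx.2.trans hbt)).continuousAt.sub continuousAt_const).continuousWithinAt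
  have hderiv : ∀ x ∈ Ico a b, HasDerivWithinAt (fun x ↦ ζ x - ζ a)
      (logField lam x (logOrbit lam t w x) + 1) (Ici x) x := fun x hx ↦
    ((hasDerivAt_zeta hlam hw (hx.2.le.trans hbt)).sub_const (ζ a)).hasDerivWithinAt
  have hBc : ContinuousOn B (Icc a b) := by
    simp only [hB]; fun_prop
  have hB' : ∀ x ∈ Ico a b, HasDerivWithinAt B (2 / (‖w‖ - 1) * Real.exp (-(c * (t - x)))) (Ici x) x := by
    intro x _
    have h1 : HasDerivAt (fun x : ℝ ↦ -(c * (t - x))) c x := by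
      have h := ((hasDerivAt_id x).const_mul c).add_const (-(c * t))
      have heq : (fun x : ℝ ↦ -(c * (t - x))) = fun x ↦ c * id x + -(c * t) := by
        ext y; simp only [id]; ring
      rw [heq]
      simpa using h
    have h2 := (h1.exp.sub_const (Real.exp (-(c * (t - a))))).const_mul (2 / ((‖w‖ - 1) * c))
    refine (h2.hasDerivWithinAt).congr_deriv ?_
    have hw1 : ‖w‖ - 1 ≠ 0 := by linarith
    field_simp
  have hbound : ∀ x ∈ Ico a b, ‖logField lam x (logOrbit lam t w x) + 1‖ ≤
      2 / (‖w‖ - 1) * Real.exp (-(c * (t - x))) := fun x hx ↦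
    norm_logField_logOrbit_add_one_le hlam hw (hx.2.le.trans hbt)
  have key := image_norm_le_of_norm_deriv_right_le_deriv_boundary' hcont hderiv
    (by simp [hB]) hBc hB' hbound (right_mem_Icc.2 hab)
  rw [dist_eq_norm]
  refine key.trans ?_
  simp only [hB]
  rw [← errConst_eq hw]
  have hM := (errConst_pos hw).le
  nlinarith [Real.exp_pos (-(c * (t - a))), hM]

/-- **The limit `logLim lam t w = lim_{s → -∞} (χ_s + s)`** ("`log f_t(w)`"), by choice of the
limit (`limUnder`). [folklore] -/
def _root_.Literature.Probability.RandomPlanarGeometry.WholePlaneLoewner.BackwardFlow.logLim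
    (lam : ℝ → ℝ) (t : ℝ) (w : ℂ) : ℂ :=
  limUnder atBot fun s ↦ logOrbit lam t w s + s

/-- `ζ_s → logLim` as `s → -∞`, with the rate `dist ζ_b logLim ≤ M_w e^{-c_w (t - b)}`, `b ≤ t`.
[folklore] -/
theorem tendsto_logLim_and_dist_le :
    Tendsto (fun s ↦ logOrbit lam t w s + s) atBot (𝓝 (logLim lam t w)) ∧
      ∀ b ≤ t, dist (logOrbit lam t w b + b) (logLim lam t w) ≤
        errConst w * Real.exp (-(growthConst w * (t - b))) := by
  obtain ⟨L, hL, hrate⟩ := exists_tendsto_atBot_of_dist_le (f := fun s ↦ logOrbit lam t w s + s)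
    (growthConst_pos' hw) (fun a b hab hbt ↦ dist_zeta_le hlam hw hab hbt)
  have hlim : Tendsto (fun s ↦ logOrbit lam t w s + s) atBot (𝓝 (logLim lam t w)) :=
    tendsto_nhds_limUnder ⟨L, hL⟩
  have hLeq : logLim lam t w = L := tendsto_nhds_unique hlim hL
  rw [hLeq]
  exact ⟨hL, hrate⟩

/-- `ζ_s → logLim lam t w` as `s → -∞`. [folklore] -/
theorem tendsto_logLim : Tendsto (fun s ↦ logOrbit lam t w s + s) atBot (𝓝 (logLim lam t w)) :=
  (tendsto_logLim_and_dist_le hlam hw).1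

/-- The rate of convergence: `dist ζ_b logLim ≤ M_w e^{-c_w (t - b)}` for `b ≤ t`. [folklore] -/
theorem dist_logLim_le {b : ℝ} (hb : b ≤ t) :
    dist (logOrbit lam t w b + b) (logLim lam t w) ≤
      errConst w * Real.exp (-(growthConst w * (t - b))) :=
  (tendsto_logLim_and_dist_le hlam hw).2 b hb

/-- **`|logLim - (log w + t)| ≤ M_w`**: the logarithm of `f_t(w)/(e^t w)` is bounded by
`2(|w| + 1)/(|w| - 1)²`. [folklore] -/
theorem norm_logLim_sub_le : ‖logLim lam t w - (Complex.log w + t)‖ ≤ errConst w := by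
  have h := dist_logLim_le hlam hw (b := t) le_rfl
  rw [logOrbit_self hlam hw, sub_self, mul_zero, neg_zero, Real.exp_zero, mul_one, dist_comm,
    dist_eq_norm] at h
  exact h

end Zeta

/-! ### The inverse Loewner map `f_t(w) = invMap lam t w` -/

/-- **The inverse whole-plane Loewner map** `f_t(w) = lim_{s → -∞} e^s u_s(w) = exp (logLim t w)`
(Lawler (2005), Prop. 4.21: `F_t = lim_{s → -∞} F_t^{(s)}`, `F_t : ℂ ∖ 𝔻̄ → D_t`, `g_t = F_t⁻¹`).
Meaningful for `|w| > 1`. [cite: Lawler2005, §4.3 Prop. 4.21] -/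
def invMap (lam : ℝ → ℝ) (t : ℝ) (w : ℂ) : ℂ := exp (logLim lam t w)

/-- Unfolding lemma. [folklore] -/
theorem invMap_apply (lam : ℝ → ℝ) (t : ℝ) (w : ℂ) : invMap lam t w = exp (logLim lam t w) := rfl

/-- `f_t(w) ≠ 0`: the origin is never in the image (it is in every hull). [folklore] -/
theorem invMap_ne_zero (lam : ℝ → ℝ) (t : ℝ) (w : ℂ) : invMap lam t w ≠ 0 := Complex.exp_ne_zero _

section InvMap

variable (hlam : Continuous lam) {t : ℝ} {w : ℂ} (hw : 1 < ‖w‖)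
include hlam hw

omit hlam hw in
/-- `e^s orbit s = exp (χ_s + s)`. [folklore] -/
theorem exp_mul_orbit (s : ℝ) :
    (Real.exp s : ℂ) * orbit lam t w s = exp (logOrbit lam t w s + s) := by
  rw [orbit, Complex.exp_add, Complex.ofReal_exp, mul_comm]

/-- **`e^s u_s(w) → f_t(w)` as `s → -∞`.** [cite: Lawler2005, §4.3 Prop. 4.21] -/
theorem tendsto_exp_mul_orbit :
    Tendsto (fun s ↦ (Real.exp s : ℂ) * orbit lam t w s) atBot (𝓝 (invMap lam t w)) := by
  have h := (Complex.continuous_exp.tendsto _).comp (tendsto_logLim (t := t) hlam hw)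
  refine h.congr fun s ↦ ?_
  simp only [Function.comp_apply]
  exact (exp_mul_orbit s).symm

/-- **Upper bound** `|f_t(w)| ≤ e^t |w| e^{M_w}`. [folklore] -/
theorem norm_invMap_le : ‖invMap lam t w‖ ≤ Real.exp t * ‖w‖ * Real.exp (errConst w) := by
  have hw0 : w ≠ 0 := norm_pos_iff.1 (by linarith)
  have h := norm_logLim_sub_le (t := t) hlam hw
  rw [invMap_apply, Complex.norm_exp]
  have hre : (logLim lam t w).re ≤ Real.log ‖w‖ + t + errConst w := by
    have h2 := abs_le.1 ((Complex.abs_re_le_norm (logLim lam t w - (Complex.log w + ↑t))).trans h)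
    simp only [Complex.sub_re, Complex.add_re, Complex.log_re, Complex.ofReal_re] at h2
    linarith [h2.2]
  calc Real.exp (logLim lam t w).re ≤ Real.exp (Real.log ‖w‖ + t + errConst w) := Real.exp_le_exp.2 hre
    _ = Real.exp t * ‖w‖ * Real.exp (errConst w) := by
      rw [Real.exp_add, Real.exp_add, Real.exp_log (by linarith)]; ring

/-- **Lower bound** `e^t |w| e^{-M_w} ≤ |f_t(w)|`. [folklore] -/
theorem le_norm_invMap : Real.exp t * ‖w‖ * Real.exp (-errConst w) ≤ ‖invMap lam t w‖ := by
  have h := norm_logLim_sub_le (t := t) hlam hw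
  rw [invMap_apply, Complex.norm_exp]
  have hre : Real.log ‖w‖ + t - errConst w ≤ (logLim lam t w).re := by
    have h2 := abs_le.1 ((Complex.abs_re_le_norm (logLim lam t w - (Complex.log w + ↑t))).trans h)
    simp only [Complex.sub_re, Complex.add_re, Complex.log_re, Complex.ofReal_re] at h2
    linarith [h2.1]
  calc Real.exp t * ‖w‖ * Real.exp (-errConst w) = Real.exp (Real.log ‖w‖ + t - errConst w) := by
        rw [sub_eq_add_neg, Real.exp_add, Real.exp_add, Real.exp_log (by linarith)]; ring
    _ ≤ Real.exp (logLim lam t w).re := Real.exp_le_exp.2 hre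

/-- **The normalisation at infinity, quantitatively**: `|f_t(w)/(e^t w) - 1| ≤ 2 M_w` as soon
as `M_w ≤ 1`. [folklore] -/
theorem norm_invMap_div_sub_one_le (hM : errConst w ≤ 1) :
    ‖invMap lam t w / ((Real.exp t : ℂ) * w) - 1‖ ≤ 2 * errConst w := by
  have hw0 : w ≠ 0 := norm_pos_iff.1 (by linarith)
  have het : (Real.exp t : ℂ) * w ≠ 0 := mul_ne_zero (Complex.ofReal_ne_zero.2 (Real.exp_pos t).ne') hw0
  have heq : invMap lam t w / ((Real.exp t : ℂ) * w) = exp (logLim lam t w - (Complex.log w + t)) := by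
    rw [invMap_apply, Complex.exp_sub, Complex.exp_add, Complex.exp_log hw0, Complex.ofReal_exp,
      mul_comm w]
  rw [heq]
  exact (Complex.norm_exp_sub_one_le ((norm_logLim_sub_le hlam hw).trans hM)).trans
    (by linarith [norm_logLim_sub_le (t := t) hlam hw])

end InvMap

/-! ### Flow property and injectivity of `f_t` -/

/-- **Flow property of the limit**: `f_{t'}(u_{t'}(w)) = f_t(w)` for `t' ≤ t`. [folklore] -/
theorem invMap_orbit (hlam : Continuous lam) {t t' : ℝ} {w : ℂ} (hw : 1 < ‖w‖) (ht' : t' ≤ t) :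
    invMap lam t' (orbit lam t w t') = invMap lam t w := by
  have hw' : 1 < ‖orbit lam t w t'‖ := one_lt_norm_orbit hlam hw ht'
  have h1 := tendsto_exp_mul_orbit (t := t') hlam hw'
  have h2 := tendsto_exp_mul_orbit (t := t) hlam hw
  have hev : (fun s ↦ (Real.exp s : ℂ) * orbit lam t' (orbit lam t w t') s) =ᶠ[atBot]
      fun s ↦ (Real.exp s : ℂ) * orbit lam t w s := by
    filter_upwards [eventually_le_atBot t'] with s hs
    rw [orbit_orbit hlam hw ht' hs]
  exact tendsto_nhds_unique (h1.congr' hev) h2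

/-- **Forward flow property of the limit**: if the trajectory through `(t, w)` is a true solution
outside the closed unit disc up to `t'' ≥ t`, then `f_{t''}(u_{t''}(w)) = f_t(w)`. [folklore] -/
theorem invMap_orbit_of_forward (hlam : Continuous lam) {t t'' : ℝ} {w : ℂ} (hw : 1 < ‖w‖)
    (htt : t ≤ t'')
    (hsol : ∀ s ≤ t'', HasDerivAt (orbit lam t w) (field lam s (orbit lam t w s)) s ∧
      1 < ‖orbit lam t w s‖) :
    invMap lam t'' (orbit lam t w t'') = invMap lam t w := by
  have hw'' : 1 < ‖orbit lam t w t''‖ := (hsol t'' le_rfl).2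
  have h1 := tendsto_exp_mul_orbit (t := t'') hlam hw''
  have h2 := tendsto_exp_mul_orbit (t := t) hlam hw
  have hev : (fun s ↦ (Real.exp s : ℂ) * orbit lam t'' (orbit lam t w t'') s) =ᶠ[atBot]
      fun s ↦ (Real.exp s : ℂ) * orbit lam t w s := by
    filter_upwards [eventually_le_atBot t''] with s hs
    rw [orbit_orbit_of_forward hlam hw htt hsol hs]
  exact tendsto_nhds_unique (h1.congr' hev) h2

/-- **`f_t` is injective on `{|w| > 1}`**: two trajectories with the same limit `f_t(w₁) = f_t(w₂)`
at `-∞` coincide (uniqueness of solutions started at `-∞`, `eqOn_of_tendsto_atBot`), so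
`w₁ = u₁(t) = u₂(t) = w₂`. Lawler (2005), Prop. 4.21 (uniqueness). [cite: Lawler2005, §4.3 Prop. 4.21] -/
theorem injOn_invMap (hlam : Continuous lam) (t : ℝ) : InjOn (invMap lam t) exteriorDisc := by
  intro w₁ hw₁ w₂ hw₂ heq
  rw [mem_exteriorDisc] at hw₁ hw₂
  have key := eqOn_of_tendsto_atBot (lam := lam) (t := t) (z := invMap lam t w₁)
    (invMap_ne_zero lam t w₁)
    (fun s hs ↦ hasDerivAt_orbit hlam hw₁ hs) (fun s hs ↦ hasDerivAt_orbit hlam hw₂ hs)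
    (fun s hs ↦ one_lt_norm_orbit hlam hw₁ hs) (fun s hs ↦ one_lt_norm_orbit hlam hw₂ hs)
    (tendsto_exp_mul_orbit hlam hw₁) (by rw [heq]; exact tendsto_exp_mul_orbit hlam hw₂) t le_rfl
  rwa [orbit_self hlam hw₁, orbit_self hlam hw₂] at key

/-! ### Uniform convergence `e^s u_s(w) → f_t(w)` on `{|w| ≥ 1 + δ}` -/

/-- **Uniform rate**: for `|w| ≥ 1 + δ` (`δ > 0`) and `s ≤ t`,
`|e^s orbit t w s - invMap t w| ≤ e^{t + M} |w| · 2 M e^{-c (t - s)}` with the constants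
`M = M_{1+δ}`, `c = c_{1+δ}` of the worst point, as soon as `M e^{-c (t - s)} ≤ 1`. [folklore] -/
theorem norm_exp_mul_orbit_sub_invMap_le (hlam : Continuous lam) {t : ℝ} {δ : ℝ} (hδ : 0 < δ)
    {w : ℂ} (hw : 1 + δ ≤ ‖w‖) {s : ℝ} (hs : s ≤ t)
    (hsmall : errConst ((1 + δ : ℝ) : ℂ) * Real.exp (-(growthConst ((1 + δ : ℝ) : ℂ) * (t - s))) ≤ 1) :
    ‖(Real.exp s : ℂ) * orbit lam t w s - invMap lam t w‖ ≤
      Real.exp t * ‖w‖ * Real.exp (errConst ((1 + δ : ℝ) : ℂ)) *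
        (2 * (errConst ((1 + δ : ℝ) : ℂ) * Real.exp (-(growthConst ((1 + δ : ℝ) : ℂ) * (t - s))))) := by
  set w₀ : ℂ := ((1 + δ : ℝ) : ℂ) with hw₀
  have hnw₀ : ‖w₀‖ = 1 + δ := by
    rw [hw₀, Complex.norm_real, Real.norm_eq_abs, abs_of_pos (by linarith)]
  have hw₀1 : 1 < ‖w₀‖ := by rw [hnw₀]; linarith
  have hw1 : 1 < ‖w‖ := by linarith
  have hle : ‖w₀‖ ≤ ‖w‖ := by rw [hnw₀]; exact hw
  -- compare the constants of `w` with those of `w₀`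
  have hM : errConst w ≤ errConst w₀ := errConst_anti hw₀1 hle
  have hc : growthConst w₀ ≤ growthConst w := growthConst_mono hw₀1 hle
  have hts : 0 ≤ t - s := by linarith
  have hexp : Real.exp (-(growthConst w * (t - s))) ≤ Real.exp (-(growthConst w₀ * (t - s))) :=
    Real.exp_le_exp.2 (neg_le_neg (mul_le_mul_of_nonneg_right hc hts))
  -- the logarithmic error
  have hlog : ‖(logOrbit lam t w s + s) - logLim lam t w‖ ≤
      errConst w₀ * Real.exp (-(growthConst w₀ * (t - s))) := by
    rw [← dist_eq_norm]
    refine (dist_logLim_le hlam hw1 hs).trans ?_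
    exact mul_le_mul hM hexp (Real.exp_pos _).le (errConst_pos hw₀1).le
  have hlog1 : ‖(logOrbit lam t w s + s) - logLim lam t w‖ ≤ 1 := hlog.trans hsmall
  -- exponentiate
  rw [exp_mul_orbit s, invMap_apply]
  have hfactor : exp (logOrbit lam t w s + ↑s) - exp (logLim lam t w) =
      exp (logLim lam t w) * (exp ((logOrbit lam t w s + ↑s) - logLim lam t w) - 1) := by
    rw [mul_sub, mul_one, ← Complex.exp_add, add_sub_cancel]
  rw [hfactor, norm_mul]
  have h1 : ‖exp (logLim lam t w)‖ ≤ Real.exp t * ‖w‖ * Real.exp (errConst w₀) := by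
    refine (norm_invMap_le hlam hw1).trans ?_
    gcongr
  have h2 : ‖exp ((logOrbit lam t w s + ↑s) - logLim lam t w) - 1‖ ≤
      2 * (errConst w₀ * Real.exp (-(growthConst w₀ * (t - s)))) :=
    (Complex.norm_exp_sub_one_le hlog1).trans (by linarith)
  exact mul_le_mul h1 h2 (norm_nonneg _) (by positivity)



/-! ### The linear equation for differences of trajectories -/

/-- The **coefficient of the linear equation** for `u_r(w) - u_r(w₀)`:
`flowCoeff t w w₀ r = a(min r t)`, `a(r) = -1 + 2W_r²/((W_r - u_r(w))(W_r - u_r(w₀)))`; the time is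
frozen at `t` after `t` to make it a globally continuous function of `r`. Lawler (2005), §4.1,
eq. (4.7) (radial form). [cite: Lawler2005, Ch. 4 §4.1] -/
def flowCoeff (lam : ℝ → ℝ) (t : ℝ) (w w₀ : ℂ) (r : ℝ) : ℂ :=
  diffCoeff lam (min r t) (orbit lam t w (min r t)) (orbit lam t w₀ (min r t))

/-- Before time `t` the coefficient is the difference coefficient along the two trajectories.
[folklore] -/
theorem flowCoeff_of_le (t : ℝ) (w w₀ : ℂ) {r : ℝ} (hr : r ≤ t) :
    flowCoeff lam t w w₀ r = diffCoeff lam r (orbit lam t w r) (orbit lam t w₀ r) := by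
  rw [flowCoeff, min_eq_left hr]

section Linear

variable (hlam : Continuous lam) {t : ℝ} {w w₀ : ℂ} (hw : 1 < ‖w‖) (hw₀ : 1 < ‖w₀‖)
include hlam hw hw₀

/-- The coefficient is continuous on `ℝ`. [folklore] -/
theorem continuous_flowCoeff : Continuous (flowCoeff lam t w w₀) := by
  have hmin : Continuous fun r : ℝ ↦ min r t := continuous_id.min continuous_const
  have hmaps : ∀ r : ℝ, min r t ∈ Iic (t + 1) := fun r ↦ by
    simp only [mem_Iic]; exact (min_le_right r t).trans (by linarith)
  have hu : Continuous fun r ↦ orbit lam t w (min r t) :=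
    (continuousOn_orbit hlam hw).comp_continuous hmin hmaps
  have hu₀ : Continuous fun r ↦ orbit lam t w₀ (min r t) :=
    (continuousOn_orbit hlam hw₀).comp_continuous hmin hmaps
  have hW : Continuous fun r ↦ drivW lam (min r t) := (continuous_drivW hlam).comp hmin
  have hden : ∀ r, (drivW lam (min r t) - orbit lam t w (min r t)) *
      (drivW lam (min r t) - orbit lam t w₀ (min r t)) ≠ 0 := fun r ↦
    mul_ne_zero (drivW_sub_ne_zero lam (one_lt_norm_orbit hlam hw (min_le_right r t)))
      (drivW_sub_ne_zero lam (one_lt_norm_orbit hlam hw₀ (min_le_right r t)))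
  have heq : flowCoeff lam t w w₀ = fun r ↦ -1 + 2 * drivW lam (min r t) ^ 2 /
      ((drivW lam (min r t) - orbit lam t w (min r t)) *
        (drivW lam (min r t) - orbit lam t w₀ (min r t))) := rfl
  rw [heq]
  exact continuous_const.add ((continuous_const.mul (hW.pow 2)).div
    ((hW.sub hu).mul (hW.sub hu₀)) hden)

/-- The coefficient is bounded: `|a(r)| ≤ 1 + 2/((|w| - 1)(|w₀| - 1))`. [folklore] -/
theorem norm_flowCoeff_le (r : ℝ) :
    ‖flowCoeff lam t w w₀ r‖ ≤ 1 + 2 / ((‖w‖ - 1) * (‖w₀‖ - 1)) := by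
  rw [flowCoeff]
  have h1 := one_lt_norm_orbit hlam hw (min_le_right r t)
  have h2 := one_lt_norm_orbit hlam hw₀ (min_le_right r t)
  refine (norm_diffCoeff_le lam h1 h2).trans ?_
  have hn1 := norm_le_norm_orbit hlam hw (min_le_right r t)
  have hn2 := norm_le_norm_orbit hlam hw₀ (min_le_right r t)
  gcongr 1 + ?_
  exact div_le_div_of_nonneg_left (by norm_num) (mul_pos (by linarith) (by linarith))
    (mul_le_mul (by linarith) (by linarith) (by linarith) (by linarith))

/-- **The linear equation for differences, solved**:
`orbit t w s - orbit t w₀ s = (w - w₀) exp (∫ₜˢ flowCoeff)` for `s ≤ t`. [cite: Lawler2005, Ch. 4 §4.1] -/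
theorem sub_eq_mul_exp_integral {s : ℝ} (hs : s ≤ t) :
    orbit lam t w s - orbit lam t w₀ s =
      (w - w₀) * exp (∫ r in t..s, flowCoeff lam t w w₀ r) := by
  set A := flowCoeff lam t w w₀ with hA
  have hAc : Continuous A := continuous_flowCoeff hlam hw hw₀
  set P : ℝ → ℂ := fun r ↦ ∫ x in t..r, A x with hP
  have hPd : ∀ r, HasDerivAt P (A r) r := fun r ↦ (hAc.integral_hasStrictDerivAt t r).hasDerivAt
  set D : ℝ → ℂ := fun r ↦ orbit lam t w r - orbit lam t w₀ r with hD
  -- the linear equation `D' = A D` on `(-∞, t]`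
  have hDd : ∀ r ≤ t, HasDerivAt D (A r * D r) r := by
    intro r hr
    have h1 := (hasDerivAt_orbit hlam hw hr).sub (hasDerivAt_orbit hlam hw₀ hr)
    have heq : field lam r (orbit lam t w r) - field lam r (orbit lam t w₀ r) = A r * D r := by
      rw [field_sub_field_eq lam (drivW_sub_ne_zero lam (one_lt_norm_orbit hlam hw hr))
        (drivW_sub_ne_zero lam (one_lt_norm_orbit hlam hw₀ hr)), hA, flowCoeff_of_le t w w₀ hr,
        hD, mul_comm]
    rw [heq] at h1
    exact h1
  -- `E = D exp(-P)` is constant on `[s, t]`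
  set E : ℝ → ℂ := fun r ↦ D r * exp (-P r) with hE
  have hEd : ∀ r ≤ t, HasDerivAt E 0 r := by
    intro r hr
    have h2 : HasDerivAt (fun r ↦ exp (-P r)) (exp (-P r) * -A r) r := (hPd r).neg.cexp
    have h3 := (hDd r hr).mul h2
    have : A r * D r * exp (-P r) + D r * (exp (-P r) * -A r) = 0 := by ring
    rwa [this] at h3
  have hEc : ContinuousOn E (Icc s t) := fun r hr ↦ (hEd r hr.2).continuousAt.continuousWithinAt
  have hconst := constant_of_has_deriv_right_zero hEc (fun r hr ↦ (hEd r hr.2.le).hasDerivWithinAt)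
    t ⟨hs, le_rfl⟩
  -- `E t = D t = w - w₀` (as `P t = 0`), so `D s = (w - w₀) exp (P s)`
  simp only [hE, hP, hD, intervalIntegral.integral_same, neg_zero, Complex.exp_zero, mul_one,
    orbit_self hlam hw, orbit_self hlam hw₀] at hconst
  -- hconst : w - w₀ = (orbit s - orbit₀ s) * exp (-∫ₜˢ A)
  have h1 : (orbit lam t w s - orbit lam t w₀ s) * exp (-∫ x in t..s, A x) * exp (∫ x in t..s, A x) =
      (w - w₀) * exp (∫ x in t..s, A x) := by rw [← hconst]
  rwa [mul_assoc, ← Complex.exp_add, neg_add_cancel, Complex.exp_zero, mul_one] at h1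

/-- **Lipschitz dependence on the initial point**:
`|orbit t w s - orbit t w₀ s| ≤ |w - w₀| exp ((1 + 2/((|w| - 1)(|w₀| - 1))) (t - s))`. [folklore] -/
theorem norm_orbit_sub_orbit_le {s : ℝ} (hs : s ≤ t) :
    ‖orbit lam t w s - orbit lam t w₀ s‖ ≤
      ‖w - w₀‖ * Real.exp ((1 + 2 / ((‖w‖ - 1) * (‖w₀‖ - 1))) * (t - s)) := by
  rw [sub_eq_mul_exp_integral hlam hw hw₀ hs, norm_mul]
  gcongr
  rw [Complex.norm_exp]
  gcongr
  refine (Complex.re_le_norm _).trans ?_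
  have := intervalIntegral.norm_integral_le_of_norm_le_const (a := t) (b := s)
    (f := flowCoeff lam t w w₀) (C := 1 + 2 / ((‖w‖ - 1) * (‖w₀‖ - 1)))
    fun r _ ↦ norm_flowCoeff_le hlam hw hw₀ r
  rw [abs_of_nonpos (by linarith : s - t ≤ 0), neg_sub] at this
  linarith

/-- `|a_{w,w₀}(r) - a_{w₀,w₀}(r)| ≤ 2 |u_r(w) - u_r(w₀)| /((|w| - 1)(|w₀| - 1)²)`. [folklore] -/
theorem norm_flowCoeff_sub_flowCoeff_le (r : ℝ) :
    ‖flowCoeff lam t w w₀ r - flowCoeff lam t w₀ w₀ r‖ ≤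
      2 / ((‖w‖ - 1) * (‖w₀‖ - 1) ^ 2) * ‖orbit lam t w (min r t) - orbit lam t w₀ (min r t)‖ := by
  set r' := min r t with hr'
  have hr't : r' ≤ t := min_le_right r t
  set W := drivW lam r' with hW
  set z₁ := orbit lam t w r' with hz₁
  set z₂ := orbit lam t w₀ r' with hz₂
  have h1 : 1 < ‖z₁‖ := one_lt_norm_orbit hlam hw hr't
  have h2 : 1 < ‖z₂‖ := one_lt_norm_orbit hlam hw₀ hr't
  have hd1 : W - z₁ ≠ 0 := drivW_sub_ne_zero lam h1
  have hd2 : W - z₂ ≠ 0 := drivW_sub_ne_zero lam h2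
  have hid : flowCoeff lam t w w₀ r - flowCoeff lam t w₀ w₀ r =
      2 * W ^ 2 * (z₁ - z₂) / ((W - z₁) * (W - z₂) ^ 2) := by
    simp only [flowCoeff, diffCoeff_apply, ← hr', ← hW, ← hz₁, ← hz₂]
    field_simp
    ring
  rw [hid, norm_div, norm_mul, norm_mul, norm_pow, norm_drivW, one_pow, mul_one,
    Complex.norm_two, norm_mul, norm_pow]
  have hb1 : ‖w‖ - 1 ≤ ‖W - z₁‖ :=
    le_trans (by linarith [norm_le_norm_orbit hlam hw hr't]) (norm_sub_one_le_norm_drivW_sub lam r' z₁)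
  have hb2 : ‖w₀‖ - 1 ≤ ‖W - z₂‖ :=
    le_trans (by linarith [norm_le_norm_orbit hlam hw₀ hr't]) (norm_sub_one_le_norm_drivW_sub lam r' z₂)
  have hp1 : (0 : ℝ) < ‖w‖ - 1 := by linarith
  have hp2 : (0 : ℝ) < ‖w₀‖ - 1 := by linarith
  rw [div_le_iff₀ (by positivity)]
  calc 2 * ‖z₁ - z₂‖ = 2 / ((‖w‖ - 1) * (‖w₀‖ - 1) ^ 2) * ‖z₁ - z₂‖ * ((‖w‖ - 1) * (‖w₀‖ - 1) ^ 2) := by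
        field_simp
    _ ≤ 2 / ((‖w‖ - 1) * (‖w₀‖ - 1) ^ 2) * ‖z₁ - z₂‖ * (‖W - z₁‖ * ‖W - z₂‖ ^ 2) := by
        gcongr

end Linear

/-! ### The flow map is holomorphic in the initial point -/

/-- **The backward flow is holomorphic in the starting point**: for `s ≤ t` the map
`w ↦ orbit lam t w s` has the complex derivative `exp ∫ₜˢ a_{w₀,w₀}` at every `w₀` with `|w₀| > 1`.
Lawler (2005), §4.1, proof of Thm. 4.6 (radial/whole-plane form, Prop. 4.21). [cite: Lawler2005, Ch. 4 §4.1] -/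
theorem hasDerivAt_orbit_initial (hlam : Continuous lam) {t s : ℝ} (hs : s ≤ t) {w₀ : ℂ}
    (hw₀ : 1 < ‖w₀‖) :
    HasDerivAt (fun w ↦ orbit lam t w s) (exp (∫ r in t..s, flowCoeff lam t w₀ w₀ r)) w₀ := by
  set I₀ : ℂ := ∫ r in t..s, flowCoeff lam t w₀ w₀ r with hI₀
  -- work on the neighbourhood `{|w| > m}`, `m = (1 + |w₀|)/2`
  set m : ℝ := (1 + ‖w₀‖) / 2 with hm
  have hm1 : 1 < m := by rw [hm]; linarith
  have hmw₀ : m < ‖w₀‖ := by rw [hm]; linarith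
  classical
  set G : ℂ → ℂ := fun w ↦ if m < ‖w‖ then ∫ r in t..s, flowCoeff lam t w w₀ r else I₀ with hG
  -- constants
  set L : ℝ := 1 + 2 / ((m - 1) * (‖w₀‖ - 1)) with hL
  set C : ℝ := 2 / ((m - 1) * (‖w₀‖ - 1) ^ 2) * Real.exp (L * (t - s)) * (t - s) with hC
  have hLpos : 0 < L := by rw [hL]; have : 0 < (m - 1) * (‖w₀‖ - 1) := mul_pos (by linarith) (by linarith); positivity
  have hGbound : ∀ w, ‖G w - I₀‖ ≤ C * ‖w - w₀‖ := by
    intro w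
    by_cases hw : m < ‖w‖
    · have hw1 : 1 < ‖w‖ := hm1.trans hw
      simp only [hG, if_pos hw, hI₀]
      rw [← intervalIntegral.integral_sub
        ((continuous_flowCoeff hlam hw1 hw₀).intervalIntegrable _ _)
        ((continuous_flowCoeff hlam hw₀ hw₀).intervalIntegrable _ _)]
      have hle : ∀ r ∈ Set.uIoc t s, ‖flowCoeff lam t w w₀ r - flowCoeff lam t w₀ w₀ r‖ ≤
          2 / ((m - 1) * (‖w₀‖ - 1) ^ 2) * Real.exp (L * (t - s)) * ‖w - w₀‖ := by
        intro r hr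
        rw [Set.uIoc_of_ge hs] at hr
        have hr' : min r t ≤ t := min_le_right r t
        have hsr : s ≤ min r t := le_min hr.1.le hs
        refine (norm_flowCoeff_sub_flowCoeff_le hlam hw1 hw₀ r).trans ?_
        have hdist := norm_orbit_sub_orbit_le hlam hw1 hw₀ hr'
        have h0 : 0 < (m - 1) * (‖w₀‖ - 1) ^ 2 := mul_pos (by linarith) (pow_pos (by linarith) 2)
        have hK : 2 / ((‖w‖ - 1) * (‖w₀‖ - 1) ^ 2) ≤ 2 / ((m - 1) * (‖w₀‖ - 1) ^ 2) :=
          div_le_div_of_nonneg_left (by norm_num : (0 : ℝ) ≤ 2) h0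
            (mul_le_mul_of_nonneg_right (by linarith) (sq_nonneg _))
        have hKnn : 0 ≤ 2 / ((‖w‖ - 1) * (‖w₀‖ - 1) ^ 2) :=
          div_nonneg (by norm_num : (0 : ℝ) ≤ 2) (mul_nonneg (by linarith) (sq_nonneg _))
        have hexp : Real.exp ((1 + 2 / ((‖w‖ - 1) * (‖w₀‖ - 1))) * (t - min r t)) ≤
            Real.exp (L * (t - s)) := by
          refine Real.exp_le_exp.2 ?_
          have h1 : 1 + 2 / ((‖w‖ - 1) * (‖w₀‖ - 1)) ≤ L := by
            rw [hL]
            have hp : 0 < (m - 1) * (‖w₀‖ - 1) := mul_pos (by linarith) (by linarith)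
            have hle : (m - 1) * (‖w₀‖ - 1) ≤ (‖w‖ - 1) * (‖w₀‖ - 1) :=
              mul_le_mul_of_nonneg_right (by linarith) (by linarith)
            have := div_le_div_of_nonneg_left (by norm_num : (0 : ℝ) ≤ 2) hp hle
            linarith
          have h2 : t - min r t ≤ t - s := by linarith
          have h3 : 0 ≤ t - min r t := by linarith
          exact mul_le_mul h1 h2 h3 hLpos.le
        calc 2 / ((‖w‖ - 1) * (‖w₀‖ - 1) ^ 2) * ‖orbit lam t w (min r t) - orbit lam t w₀ (min r t)‖
            ≤ 2 / ((‖w‖ - 1) * (‖w₀‖ - 1) ^ 2) *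
              (‖w - w₀‖ * Real.exp ((1 + 2 / ((‖w‖ - 1) * (‖w₀‖ - 1))) * (t - min r t))) :=
              mul_le_mul_of_nonneg_left hdist hKnn
          _ ≤ 2 / ((m - 1) * (‖w₀‖ - 1) ^ 2) * (‖w - w₀‖ * Real.exp (L * (t - s))) :=
              mul_le_mul hK (mul_le_mul_of_nonneg_left hexp (norm_nonneg _)) (by positivity)
                (div_nonneg (by norm_num : (0 : ℝ) ≤ 2) h0.le)
          _ = 2 / ((m - 1) * (‖w₀‖ - 1) ^ 2) * Real.exp (L * (t - s)) * ‖w - w₀‖ := by ring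
      refine (intervalIntegral.norm_integral_le_of_norm_le_const hle).trans ?_
      rw [abs_of_nonpos (by linarith : s - t ≤ 0), neg_sub, hC]
      have : 0 ≤ 2 / ((m - 1) * (‖w₀‖ - 1) ^ 2) * Real.exp (L * (t - s)) := by
        have : 0 < ‖w₀‖ - 1 := by linarith
        positivity
      nlinarith [norm_nonneg (w - w₀)]
    · simp only [hG, if_neg hw, sub_self, norm_zero]
      have : 0 ≤ C := by
        rw [hC]; have : 0 < ‖w₀‖ - 1 := by linarith
        have : 0 ≤ t - s := by linarith
        positivity
      positivity
  have hGt : Tendsto G (𝓝 w₀) (𝓝 I₀) := by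
    rw [tendsto_iff_norm_sub_tendsto_zero]
    refine squeeze_zero (fun w ↦ norm_nonneg _) hGbound ?_
    have : Tendsto (fun w : ℂ ↦ C * ‖w - w₀‖) (𝓝 w₀) (𝓝 (C * ‖w₀ - w₀‖)) :=
      tendsto_const_nhds.mul (continuous_norm.continuousAt.tendsto.comp
        (tendsto_id.sub tendsto_const_nhds))
    simpa using this
  have hexpG : Tendsto (fun w ↦ exp (G w)) (𝓝[≠] w₀) (𝓝 (exp I₀)) :=
    ((Complex.continuous_exp.continuousAt.tendsto).comp hGt).mono_left nhdsWithin_le_nhds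
  rw [hasDerivAt_iff_tendsto_slope]
  refine hexpG.congr' ?_
  have hopen : {w : ℂ | m < ‖w‖} ∈ 𝓝 w₀ := (isOpen_lt continuous_const continuous_norm).mem_nhds hmw₀
  filter_upwards [mem_nhdsWithin_of_mem_nhds hopen, self_mem_nhdsWithin] with w hw hne
  have hw : m < ‖w‖ := hw
  have hne : w ≠ w₀ := hne
  simp only [hG, if_pos hw]
  rw [slope_def_field, sub_eq_mul_exp_integral hlam (hm1.trans hw) hw₀ hs,
    mul_div_cancel_left₀ _ (sub_ne_zero.2 hne)]

/-- **The flow map `w ↦ orbit lam t w s` is holomorphic on `{|w| > 1}`** for `s ≤ t`. [cite: Lawler2005, Ch. 4 §4.1] -/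
theorem differentiableOn_orbit_initial (hlam : Continuous lam) {t s : ℝ} (hs : s ≤ t) :
    DifferentiableOn ℂ (fun w ↦ orbit lam t w s) exteriorDisc := fun _ hw ↦
  (hasDerivAt_orbit_initial hlam hs (mem_exteriorDisc.1 hw)).differentiableAt.differentiableWithinAt

/-! ### `f_t` is a locally uniform limit of holomorphic maps, hence holomorphic -/

/-- **`e^s u_s(·) → f_t` locally uniformly on `{|w| > 1}`** as `s → -∞`. [folklore] -/
theorem tendstoLocallyUniformlyOn_exp_mul_orbit (hlam : Continuous lam) (t : ℝ) :
    TendstoLocallyUniformlyOn (fun s w ↦ (Real.exp s : ℂ) * orbit lam t w s) (invMap lam t) atBot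
      exteriorDisc := by
  rw [tendstoLocallyUniformlyOn_iff_forall_isCompact isOpen_exteriorDisc]
  intro K hK hKc
  rw [Metric.tendstoUniformlyOn_iff]
  intro ε hε
  rcases K.eq_empty_or_nonempty with rfl | hne
  · exact Eventually.of_forall fun _ _ hx ↦ hx.elim
  -- `K ⊆ {1 + δ ≤ |w| ≤ R}`
  obtain ⟨w₁, hw₁K, hmin⟩ := hKc.exists_isMinOn hne continuous_norm.continuousOn
  obtain ⟨R, hR⟩ := hKc.isBounded.subset_closedBall 0
  set δ : ℝ := ‖w₁‖ - 1 with hδ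
  have hδpos : 0 < δ := by have := mem_exteriorDisc.1 (hK hw₁K); rw [hδ]; linarith
  have hKδ : ∀ w ∈ K, 1 + δ ≤ ‖w‖ := fun w hw ↦ by have h : ‖w₁‖ ≤ ‖w‖ := hmin hw; rw [hδ]; linarith
  have hKR : ∀ w ∈ K, ‖w‖ ≤ R := fun w hw ↦ by simpa using hR hw
  have hR0 : 0 ≤ R := (norm_nonneg _).trans (hKR w₁ hw₁K)
  set w₀ : ℂ := ((1 + δ : ℝ) : ℂ) with hw₀
  set M := errConst w₀ with hM
  set c := growthConst w₀ with hc
  have hnw₀ : ‖w₀‖ = 1 + δ := by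
    rw [hw₀, Complex.norm_real, Real.norm_eq_abs, abs_of_pos (by linarith)]
  have hw₀1 : 1 < ‖w₀‖ := by rw [hnw₀]; linarith
  have hcpos : 0 < c := growthConst_pos' hw₀1
  have hMpos : 0 < M := errConst_pos hw₀1
  -- the uniform bound tends to `0`
  set B : ℝ → ℝ := fun s ↦ Real.exp t * R * Real.exp M * (2 * (M * Real.exp (-(c * (t - s))))) with hB
  have hsmall : Tendsto (fun s ↦ M * Real.exp (-(c * (t - s)))) atBot (𝓝 0) := by
    have h1 : Tendsto (fun s : ℝ ↦ -(c * (t - s))) atBot atBot := by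
      have : (fun s : ℝ ↦ -(c * (t - s))) = fun s ↦ c * s + -(c * t) := by ext s; ring
      rw [this]
      exact tendsto_atBot_add_const_right _ _ (tendsto_id.const_mul_atBot hcpos)
    simpa using (Real.tendsto_exp_atBot.comp h1).const_mul M
  have hBto : Tendsto B atBot (𝓝 0) := by
    simpa [hB] using (hsmall.const_mul 2).const_mul (Real.exp t * R * Real.exp M)
  have hev1 : ∀ᶠ s in atBot, M * Real.exp (-(c * (t - s))) ≤ 1 :=
    hsmall.eventually (ge_mem_nhds one_pos)
  have hev2 : ∀ᶠ s in atBot, B s < ε := hBto.eventually (gt_mem_nhds hε)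
  filter_upwards [hev1, hev2, eventually_le_atBot t] with s hs1 hs2 hst w hwK
  rw [dist_comm, dist_eq_norm]
  refine lt_of_le_of_lt ?_ hs2
  refine (norm_exp_mul_orbit_sub_invMap_le hlam hδpos (hKδ w hwK) hst hs1).trans ?_
  simp only [hB]
  gcongr
  exact hKR w hwK

/-- **`f_t = invMap lam t` is holomorphic on `{|w| > 1}`** (locally uniform limit of the holomorphic
maps `w ↦ e^s orbit t w s`). Lawler (2005), Prop. 4.21 (`F_t` conformal). [cite: Lawler2005, §4.3 Prop. 4.21] -/
theorem differentiableOn_invMap (hlam : Continuous lam) (t : ℝ) :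
    DifferentiableOn ℂ (invMap lam t) exteriorDisc := by
  refine (tendstoLocallyUniformlyOn_exp_mul_orbit hlam t).differentiableOn ?_ isOpen_exteriorDisc
  filter_upwards [eventually_le_atBot t] with s hs
  exact (differentiableOn_orbit_initial hlam hs).const_mul _

/-- `f_t` is continuous on `{|w| > 1}`. [folklore] -/
theorem continuousOn_invMap (hlam : Continuous lam) (t : ℝ) : ContinuousOn (invMap lam t) exteriorDisc :=
  (differentiableOn_invMap hlam t).continuousOn

/-- `f_t' ≠ 0` on `{|w| > 1}` (injective holomorphic maps have non-vanishing derivative).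
[folklore] -/
theorem deriv_invMap_ne_zero (hlam : Continuous lam) (t : ℝ) {w : ℂ} (hw : w ∈ exteriorDisc) :
    deriv (invMap lam t) w ≠ 0 :=
  Literature.Analysis.Complex.SCV.deriv_ne_zero_of_injOn (differentiableOn_invMap hlam t)
    isOpen_exteriorDisc (injOn_invMap hlam t) hw

/-- **The Loewner domain `D_t = f_t({|w| > 1})` is open.** [folklore] -/
theorem isOpen_image_invMap (hlam : Continuous lam) (t : ℝ) : IsOpen (invMap lam t '' exteriorDisc) :=
  Complex.isOpen_image_of_deriv_ne_zero isOpen_exteriorDisc (differentiableOn_invMap hlam t)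
    fun _ hw ↦ deriv_invMap_ne_zero hlam t hw



/-! ### Elementary bounds on the error constant for large `|w|` -/

/-- `M_2 = 6`. [folklore] -/
theorem errConst_two : errConst (2 : ℂ) = 6 := by
  rw [errConst_apply]; norm_num

/-- For `|w| ≥ 3` the error constant is at most `6/|w|`. [folklore] -/
theorem errConst_le_div {w : ℂ} (hw : 3 ≤ ‖w‖) : errConst w ≤ 6 / ‖w‖ := by
  rw [errConst_apply, div_le_div_iff₀ (by nlinarith) (by linarith)]
  nlinarith

/-! ### The Koebe function at infinity `φ_t(ζ) = 1/f_t(1/ζ)` -/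

/-- The **Koebe function at infinity** of the whole-plane chain at time `t`:
`φ_t(ζ) = 1/f_t(1/ζ)` for `ζ ≠ 0` and `φ_t(0) = 0` (Lawler (2005), §3.2: `F_K(z) = 1/f_K(1/z)`).
[cite: Lawler2005, §3.2] -/
def koebeAtInfty (lam : ℝ → ℝ) (t : ℝ) (ζ : ℂ) : ℂ :=
  if ζ = 0 then 0 else (invMap lam t ζ⁻¹)⁻¹

/-- `φ_t(0) = 0`. [folklore] -/
@[simp] theorem koebeAtInfty_zero (lam : ℝ → ℝ) (t : ℝ) : koebeAtInfty lam t 0 = 0 := by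
  simp [koebeAtInfty]

/-- `φ_t(ζ) = (f_t(ζ⁻¹))⁻¹` for `ζ ≠ 0`. [folklore] -/
theorem koebeAtInfty_of_ne_zero (lam : ℝ → ℝ) (t : ℝ) {ζ : ℂ} (hζ : ζ ≠ 0) :
    koebeAtInfty lam t ζ = (invMap lam t ζ⁻¹)⁻¹ := by
  simp [koebeAtInfty, hζ]

/-- `φ_t(ζ) ≠ 0` for `ζ ≠ 0`. [folklore] -/
theorem koebeAtInfty_ne_zero (lam : ℝ → ℝ) (t : ℝ) {ζ : ℂ} (hζ : ζ ≠ 0) :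
    koebeAtInfty lam t ζ ≠ 0 := by
  rw [koebeAtInfty_of_ne_zero lam t hζ]
  exact inv_ne_zero (invMap_ne_zero lam t _)

/-- A point of the punctured unit disc inverts into the exterior of the closed unit disc.
[folklore] -/
theorem inv_mem_exteriorDisc {ζ : ℂ} (hζ0 : ζ ≠ 0) (hζ1 : ‖ζ‖ < 1) : ζ⁻¹ ∈ exteriorDisc := by
  rw [mem_exteriorDisc, norm_inv]
  exact one_lt_inv₀ (norm_pos_iff.2 hζ0) |>.2 hζ1

/-- `φ_t` is holomorphic on the punctured unit disc. [folklore] -/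
theorem differentiableOn_koebeAtInfty_punctured (hlam : Continuous lam) (t : ℝ) :
    DifferentiableOn ℂ (koebeAtInfty lam t) (ball 0 1 \ {0}) := by
  have h1 : DifferentiableOn ℂ (fun ζ : ℂ ↦ ζ⁻¹) (ball 0 1 \ {0}) :=
    differentiableOn_inv.mono fun ζ hζ ↦ hζ.2
  have hmaps : MapsTo (fun ζ : ℂ ↦ ζ⁻¹) (ball 0 1 \ {0}) exteriorDisc := fun ζ hζ ↦
    inv_mem_exteriorDisc hζ.2 (by simpa using hζ.1)
  have h2 : DifferentiableOn ℂ (fun ζ ↦ (invMap lam t ζ⁻¹)⁻¹) (ball 0 1 \ {0}) :=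
    ((differentiableOn_invMap hlam t).comp h1 hmaps).inv fun ζ _ ↦ invMap_ne_zero lam t _
  refine h2.congr fun ζ hζ ↦ ?_
  exact koebeAtInfty_of_ne_zero lam t hζ.2

/-- Growth of `φ_t` at the origin: `|φ_t(ζ)| ≤ e^{6 - t} |ζ|` for `|ζ| ≤ 1/2`. [folklore] -/
theorem norm_koebeAtInfty_le (hlam : Continuous lam) (t : ℝ) {ζ : ℂ} (hζ : ‖ζ‖ ≤ 1 / 2) :
    ‖koebeAtInfty lam t ζ‖ ≤ Real.exp (6 - t) * ‖ζ‖ := by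
  rcases eq_or_ne ζ 0 with rfl | hζ0
  · simp
  have hζpos : 0 < ‖ζ‖ := norm_pos_iff.2 hζ0
  have hw : 2 ≤ ‖ζ⁻¹‖ := by
    rw [norm_inv, le_inv_comm₀ (by norm_num : (0 : ℝ) < 2) hζpos]
    simpa [one_div] using hζ
  have hw1 : 1 < ‖ζ⁻¹‖ := by linarith
  have hM : errConst ζ⁻¹ ≤ 6 := by
    rw [← errConst_two]
    exact errConst_anti (by simp) (by simpa using hw)
  have hlow := le_norm_invMap (t := t) hlam hw1
  rw [koebeAtInfty_of_ne_zero lam t hζ0, norm_inv]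
  have hpos : 0 < Real.exp t * ‖ζ⁻¹‖ * Real.exp (-errConst ζ⁻¹) := by positivity
  calc ‖invMap lam t ζ⁻¹‖⁻¹ ≤ (Real.exp t * ‖ζ⁻¹‖ * Real.exp (-errConst ζ⁻¹))⁻¹ :=
        (inv_le_inv₀ (hpos.trans_le hlow) hpos).2 hlow
    _ = Real.exp (-t) * ‖ζ‖ * Real.exp (errConst ζ⁻¹) := by
        rw [norm_inv, mul_inv, mul_inv, inv_inv, ← Real.exp_neg, ← Real.exp_neg, neg_neg]
    _ ≤ Real.exp (-t) * ‖ζ‖ * Real.exp 6 := by gcongr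
    _ = Real.exp (6 - t) * ‖ζ‖ := by rw [sub_eq_add_neg, Real.exp_add]; ring

/-- `φ_t` is continuous at the origin. [folklore] -/
theorem continuousAt_koebeAtInfty (hlam : Continuous lam) (t : ℝ) :
    ContinuousAt (koebeAtInfty lam t) 0 := by
  rw [ContinuousAt, koebeAtInfty_zero]
  refine squeeze_zero_norm' (a := fun ζ ↦ Real.exp (6 - t) * ‖ζ‖) ?_ ?_
  · filter_upwards [Metric.ball_mem_nhds (0 : ℂ) (by norm_num : (0 : ℝ) < 1 / 2)] with ζ hζ
    exact norm_koebeAtInfty_le hlam t (by simpa using (mem_ball_zero_iff.1 hζ).le)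
  · simpa using ((continuous_norm.tendsto (0 : ℂ)).const_mul (Real.exp (6 - t)))

/-- **`φ_t` is holomorphic on the unit disc** (removable singularity at `0`). [folklore] -/
theorem differentiableOn_koebeAtInfty (hlam : Continuous lam) (t : ℝ) :
    DifferentiableOn ℂ (koebeAtInfty lam t) (ball 0 1) := by
  intro ζ hζ
  rcases eq_or_ne ζ 0 with rfl | hζ0
  · have hev : ∀ᶠ z in 𝓝[≠] (0 : ℂ), DifferentiableAt ℂ (koebeAtInfty lam t) z := by
      have : ball (0 : ℂ) 1 \ {0} ∈ 𝓝[≠] (0 : ℂ) :=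
        sdiff_mem_nhdsWithin_compl (Metric.ball_mem_nhds 0 one_pos) _
      filter_upwards [this] with z hz
      exact (differentiableOn_koebeAtInfty_punctured hlam t z hz).differentiableAt
        ((isOpen_ball.sdiff isClosed_singleton).mem_nhds hz)
    exact (Complex.analyticAt_of_differentiable_on_punctured_nhds_of_continuousAt hev
      (continuousAt_koebeAtInfty hlam t)).differentiableAt.differentiableWithinAt
  · exact ((differentiableOn_koebeAtInfty_punctured hlam t ζ ⟨hζ, hζ0⟩).differentiableAt
      ((isOpen_ball.sdiff isClosed_singleton).mem_nhds ⟨hζ, hζ0⟩)).differentiableWithinAt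

/-- **`φ_t` is injective on the unit disc.** [folklore] -/
theorem injOn_koebeAtInfty (hlam : Continuous lam) (t : ℝ) : InjOn (koebeAtInfty lam t) (ball 0 1) := by
  intro ζ₁ hζ₁ ζ₂ hζ₂ heq
  rcases eq_or_ne ζ₁ 0 with rfl | h₁
  · rw [koebeAtInfty_zero] at heq
    by_contra h₂
    exact koebeAtInfty_ne_zero lam t (Ne.symm h₂) heq.symm
  rcases eq_or_ne ζ₂ 0 with rfl | h₂
  · rw [koebeAtInfty_zero] at heq
    exact (koebeAtInfty_ne_zero lam t h₁ heq).elim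
  rw [koebeAtInfty_of_ne_zero lam t h₁, koebeAtInfty_of_ne_zero lam t h₂, inv_inj] at heq
  have := injOn_invMap hlam t (inv_mem_exteriorDisc h₁ (by simpa using hζ₁))
    (inv_mem_exteriorDisc h₂ (by simpa using hζ₂)) heq
  exact inv_inj.1 this

/-- The normalised quotient `q_t(w) = f_t(w)/(e^t w)` is within `12/|w|` of `1` for `|w| ≥ 6`.
[folklore] -/
theorem norm_quot_sub_one_le (hlam : Continuous lam) (t : ℝ) {w : ℂ} (hw : 6 ≤ ‖w‖) :
    ‖invMap lam t w / ((Real.exp t : ℂ) * w) - 1‖ ≤ 12 / ‖w‖ := by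
  have hw1 : 1 < ‖w‖ := by linarith
  have hM : errConst w ≤ 6 / ‖w‖ := errConst_le_div (by linarith)
  have hM1 : errConst w ≤ 1 := hM.trans ((div_le_one (by linarith)).2 hw)
  refine (norm_invMap_div_sub_one_le hlam hw1 hM1).trans ?_
  calc 2 * errConst w ≤ 2 * (6 / ‖w‖) := by gcongr
    _ = 12 / ‖w‖ := by ring

/-- **`φ_t'(0) = e^{-t}`**: `φ_t(ζ)/ζ = w/f_t(w) → e^{-t}` (`w = 1/ζ → ∞`), the capacity
normalisation `f_t(w) ∼ e^t w`. Lawler (2005), §3.2 (`cap(K) = -log f_K'(0)`).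
[cite: Lawler2005, §3.2] -/
theorem hasDerivAt_koebeAtInfty (hlam : Continuous lam) (t : ℝ) :
    HasDerivAt (koebeAtInfty lam t) (Real.exp (-t) : ℂ) 0 := by
  rw [hasDerivAt_iff_tendsto_slope]
  -- the normalised quotient tends to `1` along `ζ ↦ ζ⁻¹`, `ζ → 0`
  set q : ℂ → ℂ := fun ζ ↦ invMap lam t ζ⁻¹ / ((Real.exp t : ℂ) * ζ⁻¹) with hq
  have hq1 : Tendsto q (𝓝[≠] 0) (𝓝 1) := by
    rw [tendsto_iff_norm_sub_tendsto_zero]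
    have hbound : ∀ᶠ ζ in 𝓝[≠] (0 : ℂ), ‖q ζ - 1‖ ≤ 12 * ‖ζ‖ := by
      have hmem : ball (0 : ℂ) (1 / 6) \ {0} ∈ 𝓝[≠] (0 : ℂ) :=
        sdiff_mem_nhdsWithin_compl (Metric.ball_mem_nhds 0 (by norm_num)) _
      filter_upwards [hmem] with ζ hζ
      have hζ0 : ζ ≠ 0 := hζ.2
      have hζpos : 0 < ‖ζ‖ := norm_pos_iff.2 hζ0
      have hζlt : ‖ζ‖ < 1 / 6 := by simpa using hζ.1
      have hw : 6 ≤ ‖ζ⁻¹‖ := by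
        rw [norm_inv, le_inv_comm₀ (by norm_num : (0 : ℝ) < 6) hζpos, ← one_div]
        exact hζlt.le
      have h := norm_quot_sub_one_le hlam t hw
      rw [norm_inv, div_inv_eq_mul] at h
      exact h
    refine squeeze_zero_norm' (by simpa using hbound) ?_
    have : Tendsto (fun ζ : ℂ ↦ 12 * ‖ζ‖) (𝓝 0) (𝓝 (12 * ‖(0 : ℂ)‖)) :=
      (continuous_norm.tendsto _).const_mul 12
    simpa using this.mono_left nhdsWithin_le_nhds
  have hq2 : Tendsto (fun ζ ↦ (Real.exp (-t) : ℂ) * (q ζ)⁻¹) (𝓝[≠] 0) (𝓝 (Real.exp (-t) : ℂ)) := by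
    have := (hq1.inv₀ one_ne_zero).const_mul (Real.exp (-t) : ℂ)
    simpa using this
  refine hq2.congr' ?_
  filter_upwards [self_mem_nhdsWithin] with ζ hζ
  have hζ : ζ ≠ 0 := hζ
  have het : (Real.exp t : ℂ) ≠ 0 := Complex.ofReal_ne_zero.2 (Real.exp_pos t).ne'
  have hf : invMap lam t ζ⁻¹ ≠ 0 := invMap_ne_zero lam t _
  rw [slope_def_field, koebeAtInfty_of_ne_zero lam t hζ, koebeAtInfty_zero, sub_zero, sub_zero, hq]
  simp only
  rw [Complex.ofReal_exp, Complex.ofReal_neg, Complex.exp_neg, ← Complex.ofReal_exp]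
  field_simp

/-- `deriv φ_t 0 = e^{-t}`. [folklore] -/
theorem deriv_koebeAtInfty (hlam : Continuous lam) (t : ℝ) :
    deriv (koebeAtInfty lam t) 0 = (Real.exp (-t) : ℂ) :=
  (hasDerivAt_koebeAtInfty hlam t).deriv

/-! ### Koebe's one-quarter theorem at infinity -/

/-- **Rescaled Koebe at infinity.** For `0 < ρ ≤ 1`, the ball `B(0, ρ e^{-t}/4)` is covered by
`φ_t(B(0, ρ))` (Koebe's one-quarter theorem, `koebeQuarter_holds`, applied to the univalent map
`ζ ↦ φ_t(ρ ζ)` of the unit disc, whose derivative at `0` is `ρ e^{-t}`). [cite: Lawler2005, Thm. 3.17] -/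
theorem ball_subset_image_koebeAtInfty (hlam : Continuous lam) (t : ℝ) {ρ : ℝ} (hρ : 0 < ρ)
    (hρ1 : ρ ≤ 1) :
    ball (0 : ℂ) (ρ * Real.exp (-t) / 4) ⊆ koebeAtInfty lam t '' ball 0 ρ := by
  set ψ : ℂ → ℂ := fun ζ ↦ koebeAtInfty lam t (ρ * ζ) with hψ
  have hmaps : MapsTo (fun ζ : ℂ ↦ (ρ : ℂ) * ζ) (ball 0 1) (ball 0 ρ) := by
    intro ζ hζ
    rw [mem_ball_zero_iff] at hζ ⊢
    rw [norm_mul, Complex.norm_real, Real.norm_eq_abs, abs_of_pos hρ]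
    calc ρ * ‖ζ‖ < ρ * 1 := mul_lt_mul_of_pos_left hζ hρ
      _ = ρ := mul_one ρ
  have hsub : ball (0 : ℂ) ρ ⊆ ball 0 1 := Metric.ball_subset_ball hρ1
  have hdiff : DifferentiableOn ℂ ψ (ball 0 1) :=
    (differentiableOn_koebeAtInfty hlam t).comp ((differentiableOn_id.const_mul _))
      (hmaps.mono_right hsub)
  have hinj : InjOn ψ (ball 0 1) := by
    intro ζ₁ hζ₁ ζ₂ hζ₂ heq
    have h := injOn_koebeAtInfty hlam t (hsub (hmaps hζ₁)) (hsub (hmaps hζ₂)) heq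
    exact mul_left_cancel₀ (Complex.ofReal_ne_zero.2 hρ.ne') h
  have hderiv : deriv ψ 0 = ρ * (Real.exp (-t) : ℂ) := by
    have h1 : HasDerivAt (fun ζ : ℂ ↦ (ρ : ℂ) * ζ) (ρ : ℂ) 0 := by
      simpa using (hasDerivAt_id (0 : ℂ)).const_mul (ρ : ℂ)
    have h2 : HasDerivAt (koebeAtInfty lam t) (Real.exp (-t) : ℂ) ((ρ : ℂ) * 0) := by
      rw [mul_zero]; exact hasDerivAt_koebeAtInfty hlam t
    have h3 := h2.comp (0 : ℂ) h1
    rw [show ψ = koebeAtInfty lam t ∘ fun ζ : ℂ ↦ (ρ : ℂ) * ζ from rfl, h3.deriv]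
    ring
  have hK := Literature.Analysis.Complex.koebeQuarter_holds ψ hdiff hinj
  have hψ0 : ψ 0 = 0 := by simp [hψ]
  rw [hψ0, hderiv, norm_mul, Complex.norm_real, Real.norm_eq_abs, abs_of_pos hρ, Complex.norm_real,
    Real.norm_eq_abs, abs_of_pos (Real.exp_pos _)] at hK
  intro z hz
  obtain ⟨ζ, hζ, hζz⟩ := hK hz
  exact ⟨ρ * ζ, hmaps hζ, hζz⟩

/-- **The far field belongs to the Loewner domain**: every `z` with `|z| > 4 e^t` is a value
`f_t(w)`, `|w| > 1`; i.e. the hull `K_t = ℂ ∖ f_t({|w| > 1})` is contained in `B̄(0, 4e^t)`.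
Lawler (2005), Prop. 4.21 with Cor. 3.19 (`rad(K) ≤ 4 e^{cap K}`). [cite: Lawler2005, §4.3 Prop. 4.21] -/
theorem mem_image_invMap_of_lt (hlam : Continuous lam) (t : ℝ) {z : ℂ} (hz : 4 * Real.exp t < ‖z‖) :
    z ∈ invMap lam t '' exteriorDisc := by
  have hzpos : 0 < ‖z‖ := lt_of_le_of_lt (by positivity) hz
  have hz0 : z ≠ 0 := norm_pos_iff.1 hzpos
  have hmem : z⁻¹ ∈ ball (0 : ℂ) (1 * Real.exp (-t) / 4) := by
    rw [mem_ball_zero_iff, norm_inv, one_mul, Real.exp_neg, lt_div_iff₀ (by norm_num : (0 : ℝ) < 4)]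
    rw [inv_mul_eq_div, div_lt_iff₀ hzpos, ← div_eq_inv_mul, lt_div_iff₀ (Real.exp_pos t)]
    linarith
  obtain ⟨ζ, hζ, hζz⟩ := ball_subset_image_koebeAtInfty hlam t one_pos le_rfl hmem
  have hζ0 : ζ ≠ 0 := by
    rintro rfl
    rw [koebeAtInfty_zero] at hζz
    exact inv_ne_zero hz0 hζz.symm
  refine ⟨ζ⁻¹, inv_mem_exteriorDisc hζ0 (by simpa using hζ), ?_⟩
  rw [koebeAtInfty_of_ne_zero lam t hζ0, inv_inj] at hζz
  exact hζz

/-- **`|f_t(w)| ≤ 4 R e^t` for `1 < |w| ≤ R`**: near the circle `f_t` stays bounded (Koebe at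
infinity, rescaled by `1/R`); equivalently `g_t(z) → ∞` as `z → ∞`. [cite: Lawler2005, Thm. 3.17] -/
theorem norm_invMap_le_of_norm_le (hlam : Continuous lam) (t : ℝ) {w : ℂ} (hw : 1 < ‖w‖) {R : ℝ}
    (hwR : ‖w‖ ≤ R) : ‖invMap lam t w‖ ≤ 4 * R * Real.exp t := by
  have hR : 1 < R := hw.trans_le hwR
  have hR0 : 0 < R := by linarith
  by_contra hlt
  push Not at hlt
  set z := invMap lam t w with hz
  have hzpos : 0 < ‖z‖ := lt_of_le_of_lt (by positivity) hlt
  have hz0 : z ≠ 0 := norm_pos_iff.1 hzpos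
  -- `z⁻¹` is covered by `φ_t(B(0, 1/R))`
  have hmem : z⁻¹ ∈ ball (0 : ℂ) (R⁻¹ * Real.exp (-t) / 4) := by
    rw [mem_ball_zero_iff, norm_inv, Real.exp_neg, lt_div_iff₀ (by norm_num : (0 : ℝ) < 4),
      ← mul_inv, inv_mul_eq_div, div_lt_iff₀ hzpos, ← div_eq_inv_mul,
      lt_div_iff₀ (by positivity)]
    linarith
  obtain ⟨ζ, hζ, hζz⟩ := ball_subset_image_koebeAtInfty hlam t (inv_pos.2 hR0)
    (inv_le_one_of_one_le₀ hR.le) hmem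
  have hζ0 : ζ ≠ 0 := by
    rintro rfl
    rw [koebeAtInfty_zero] at hζz
    exact inv_ne_zero hz0 hζz.symm
  have hζlt : ‖ζ‖ < R⁻¹ := by simpa using hζ
  rw [koebeAtInfty_of_ne_zero lam t hζ0, inv_inj] at hζz
  -- injectivity: `w = ζ⁻¹`, so `|w| > R`
  have hζ1 : ‖ζ‖ < 1 := hζlt.trans (inv_lt_one_of_one_lt₀ hR)
  have hweq : ζ⁻¹ = w := injOn_invMap hlam t (inv_mem_exteriorDisc hζ0 hζ1) (mem_exteriorDisc.2 hw) hζz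
  have : R < ‖w‖ := by
    rw [← hweq, norm_inv]
    exact (lt_inv_comm₀ hR0 (norm_pos_iff.2 hζ0)).2 hζlt
  linarith

/-! ### The capacity normalisation `z / g_t(z) → e^t` -/

/-- **Capacity normalisation at infinity.** With `g_t = f_t⁻¹` on `D_t = f_t({|w| > 1})`
(`Function.invFunOn`), `z / g_t(z) → e^t` as `z → ∞` within `D_t`: `g_t(∞) = ∞`,
`g_t'(∞) = e^{-t}`, i.e. `cap(K_t) = t`. Lawler (2005), Prop. 4.21 (`g_t(z) ∼ e^{-t} z`).
[cite: Lawler2005, §4.3 Prop. 4.21] -/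
theorem tendsto_div_invFunOn_invMap (hlam : Continuous lam) (t : ℝ) :
    Tendsto (fun z ↦ z / Function.invFunOn (invMap lam t) exteriorDisc z)
      (cocompact ℂ ⊓ 𝓟 (invMap lam t '' exteriorDisc)) (𝓝 (Real.exp t : ℂ)) := by
  set g := Function.invFunOn (invMap lam t) exteriorDisc with hg
  rw [((Filter.hasBasis_cocompact).inf_principal _).tendsto_iff Metric.nhds_basis_ball]
  intro ε hε
  -- choose `R'` so large that `e^t · 12/R' < ε` (and `R' ≥ 6`), then `R = 4 R' e^t`
  set R' : ℝ := max 6 (12 * Real.exp t / ε + 1) with hR'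
  have hR'6 : 6 ≤ R' := le_max_left _ _
  have hR'pos : 0 < R' := by linarith
  have hR'ε : Real.exp t * (12 / R') < ε := by
    have h1 : 12 * Real.exp t / ε < R' := lt_of_lt_of_le (by linarith) (le_max_right _ _)
    rw [div_lt_iff₀ hε] at h1
    rw [mul_div_assoc', div_lt_iff₀ hR'pos]
    linarith
  refine ⟨closedBall 0 (4 * R' * Real.exp t), isCompact_closedBall _ _, ?_⟩
  rintro z ⟨hzR, hzD⟩
  rw [mem_compl_iff, mem_closedBall_zero_iff, not_le] at hzR
  -- `z = f_t(w)`, `w = g z`, `|w| > R'`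
  have hwmem : g z ∈ exteriorDisc := Function.invFunOn_mem hzD
  have hw1 : 1 < ‖g z‖ := mem_exteriorDisc.1 hwmem
  have hzw : invMap lam t (g z) = z := Function.invFunOn_eq hzD
  have hwR' : R' < ‖g z‖ := by
    by_contra hle
    push Not at hle
    have := norm_invMap_le_of_norm_le hlam t hw1 hle
    rw [hzw] at this
    linarith
  have hw6 : 6 ≤ ‖g z‖ := hR'6.trans hwR'.le
  have hq := norm_quot_sub_one_le hlam t hw6
  rw [hzw] at hq
  rw [mem_ball, dist_eq_norm]
  have hw0 : g z ≠ 0 := norm_pos_iff.1 (by linarith)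
  have het : (Real.exp t : ℂ) ≠ 0 := Complex.ofReal_ne_zero.2 (Real.exp_pos t).ne'
  have heq : z / g z - (Real.exp t : ℂ) = (Real.exp t : ℂ) * (z / ((Real.exp t : ℂ) * g z) - 1) := by
    field_simp
  rw [heq, norm_mul, Complex.norm_real, Real.norm_eq_abs, abs_of_pos (Real.exp_pos t)]
  calc Real.exp t * ‖z / (↑(Real.exp t) * g z) - 1‖ ≤ Real.exp t * (12 / ‖g z‖) := by gcongr
    _ ≤ Real.exp t * (12 / R') := by gcongr
    _ < ε := hR'ε

end WholePlaneLoewner.BackwardFlow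

end Literature.Probability.RandomPlanarGeometry
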